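import Mathlib.Analysis.Complex.Basic
import Mathlib.Algebra.BigOperators.Ring.Finset
import Mathlib.Data.ZMod.Basic

/-!
# Route FeketeSOS — crux `FeketeSOSHard` (stmt-ValiantsHypothesis-3996), line `paley-rip`:
# rank-one operator tameness (the additive-energy identity, complex-weighted)

Context.  The open stub `stub_tameReduction` (C) of the line of record `Cruxes/FeketeSOSHard/Lines/paley_rip.lean`
is crux-equivalent modulo the engine `stub_paleyFlatRIP` (`…PaleyRIPTameStatus.lean`, p576568).  The repair
census `Cruxes/FeketeSOSHard/Lines/paley-rip-stub3-census.md` isolates the one reshape of C with content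
independent of the crux — OPERATOR TAMENESS `T(r,m;F)`: every anti-diagonal pattern
`y(n) = Σ_{a+b=n} τ_{ab}` of a complex symmetric matrix `τ` of rank `≤ r` supported on an `m`-set `S` has a
preimage on `S × S` of nuclear norm `≤ F·‖y‖_∞` (the line needs `F = r^{O(1)} m^{1+o(1)}`; `F = m^{3/2}` is
trivial for every `r`).  This file proves the case `r = 1` with `F ≤ #supp(y)^{1/2} ≤ m`, on any finite
additive group `G` (for the line: `G = ℤ/p`):

* `sum_conv_normSq_eq_sum_autocorr_normSq` — for `w : G → ℂ`, with `(w∗w)(n) = Σ_a w(a)w(n−a)` and the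
  autocorrelation `R_w(d) = Σ_a w(a+d)·conj(w(a))`:  `Σ_n |(w∗w)(n)|² = Σ_d |R_w(d)|²`
  (both equal the complex-weighted additive energy `Σ_{a+b=c+d} w_a w_b \bar w_c \bar w_d`);
* `sq_sum_normSq_le_sum_conv_normSq` — hence `(Σ_a |w(a)|²)² = R_w(0)² ≤ Σ_n |(w∗w)(n)|²`
  (the trivial lower bound `E(A) ≥ |A|²` for additive energy, weighted);
* `rankOne_tame` — so if `|(w∗w)(n)| ≤ M` everywhere and `w∗w` vanishes off a finite set `T`, then
  `(Σ_a |w(a)|²)² ≤ #T · M²`: the mass `‖w‖₂²` of the rank-one matrix `w wᵀ` is at most `√#T · ‖w∗w‖_∞`,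
  `T ⊆ supp w + supp w`.  A single square can never be "wild": its archimedean mass is controlled by the
  sup-norm of its own cyclic pattern.

Honest framing: this is rung `r = 1` of a PROPOSED reshape, not a registered stub; `r = 2` (near-zero-divisor
pairs `A∗B` in `ℂ[ℤ/p]`) is open; nothing here bears on the crux or on `VP ≠ VNP`.
-/

set_option linter.dupNamespace false

namespace Summit.ValiantsHypothesis.ValiantsHypothesis.Theorems.FeketeSOSHardPaleyRIP

open Finset
open scoped BigOperators ComplexConjugate

section RankOne

variable {G : Type*} [AddCommGroup G] [Fintype G]

/-- The autocorrelation at lag `0` is the mass: `R_w(0) = Σ_a |w(a)|²` (as a complex number). [folklore] -/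
theorem autocorr_zero (w : G → ℂ) :
    (∑ a, w (a + 0) * conj (w a)) = ((∑ a, ‖w a‖ ^ 2 : ℝ) : ℂ) := by
  push_cast
  refine Finset.sum_congr rfl fun a _ => ?_
  rw [add_zero, Complex.mul_conj, Complex.normSq_eq_norm_sq]
  push_cast
  ring

/-- Both `Σ_n |(w∗w)(n)|²` and `Σ_d |R_w(d)|²` equal the double sum `Σ_{a,c} w(a) \bar w(c) R_w(c − a)`:
the convolution side. [folklore] -/
theorem sum_conv_normSq_eq_double (w : G → ℂ) :
    (((∑ n, ‖∑ a, w a * w (n - a)‖ ^ 2 : ℝ)) : ℂ) =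
      ∑ a, ∑ c, w a * conj (w c) * ∑ n, w (n + (c - a)) * conj (w n) := by
  push_cast
  have key : ∀ n : G, ((‖∑ a, w a * w (n - a)‖ : ℝ) : ℂ) ^ 2 =
      ∑ a, ∑ c, w a * conj (w c) * (w (n - a) * conj (w (n - c))) := by
    intro n
    rw [← Complex.ofReal_pow, ← Complex.normSq_eq_norm_sq, ← Complex.mul_conj, map_sum,
      Finset.sum_mul_sum]
    refine Finset.sum_congr rfl fun a _ => Finset.sum_congr rfl fun c _ => ?_
    rw [map_mul]; ring
  rw [Finset.sum_congr rfl fun n _ => key n, Finset.sum_comm]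
  refine Finset.sum_congr rfl fun a _ => ?_
  rw [Finset.sum_comm]
  refine Finset.sum_congr rfl fun c _ => ?_
  rw [← Finset.mul_sum]
  congr 1
  -- `Σ_n w(n − a) \bar w(n − c) = Σ_n w(n + (c − a)) \bar w(n)` : substitute `n ↦ n + c`
  rw [← Equiv.sum_comp (Equiv.addRight c)]
  refine Finset.sum_congr rfl fun n _ => ?_
  simp only [Equiv.coe_addRight]
  congr 2
  · abel
  · congr 1; abel

/-- The autocorrelation side of the same double sum. [folklore] -/
theorem sum_autocorr_normSq_eq_double (w : G → ℂ) :
    (((∑ d, ‖∑ a, w (a + d) * conj (w a)‖ ^ 2 : ℝ)) : ℂ) =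
      ∑ a, ∑ c, w a * conj (w c) * ∑ n, w (n + (c - a)) * conj (w n) := by
  push_cast
  have key : ∀ d : G, ((‖∑ a, w (a + d) * conj (w a)‖ : ℝ) : ℂ) ^ 2 =
      ∑ c, (∑ a, w (a + d) * conj (w a)) * (conj (w (c + d)) * w c) := by
    intro d
    rw [← Complex.ofReal_pow, ← Complex.normSq_eq_norm_sq, ← Complex.mul_conj, map_sum, Finset.mul_sum]
    refine Finset.sum_congr rfl fun c _ => ?_
    rw [map_mul, Complex.conj_conj]
  rw [Finset.sum_congr rfl fun d _ => key d, Finset.sum_comm]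
  -- now: `Σ_c Σ_d R(d) \bar w(c+d) w(c)`; substitute `d ↦ d − c`
  refine Finset.sum_congr rfl fun c _ => ?_
  conv_lhs => rw [← Equiv.sum_comp (Equiv.subRight c)]
  refine Finset.sum_congr rfl fun d _ => ?_
  simp only [Equiv.subRight_apply, add_sub_cancel]
  ring

/-- **The additive-energy identity, complex-weighted**: for `w : G → ℂ` on a finite additive group,
`Σ_n |Σ_a w(a)w(n−a)|² = Σ_d |Σ_a w(a+d)\bar w(a)|²`. [folklore] -/
theorem sum_conv_normSq_eq_sum_autocorr_normSq (w : G → ℂ) :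
    ∑ n, ‖∑ a, w a * w (n - a)‖ ^ 2 = ∑ d, ‖∑ a, w (a + d) * conj (w a)‖ ^ 2 := by
  have h := (sum_conv_normSq_eq_double w).trans (sum_autocorr_normSq_eq_double w).symm
  exact_mod_cast h

/-- **Mass is controlled by the self-convolution**: `(Σ_a |w(a)|²)² ≤ Σ_n |(w∗w)(n)|²` (keep the lag `d = 0` of
the autocorrelation side). [folklore] -/
theorem sq_sum_normSq_le_sum_conv_normSq (w : G → ℂ) :
    (∑ a, ‖w a‖ ^ 2) ^ 2 ≤ ∑ n, ‖∑ a, w a * w (n - a)‖ ^ 2 := by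
  rw [sum_conv_normSq_eq_sum_autocorr_normSq]
  have h0 : ‖∑ a, w (a + 0) * conj (w a)‖ ^ 2 = (∑ a, ‖w a‖ ^ 2) ^ 2 := by
    rw [autocorr_zero, Complex.norm_real, Real.norm_eq_abs,
      abs_of_nonneg (Finset.sum_nonneg fun a _ => sq_nonneg _)]
  rw [← h0]
  exact Finset.single_le_sum (f := fun d => ‖∑ a, w (a + d) * conj (w a)‖ ^ 2)
    (fun d _ => sq_nonneg _) (Finset.mem_univ 0)

/-- **Rank-one operator tameness.**  If the self-convolution `w∗w` is bounded by `M` and vanishes off a finite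
set `T` (e.g. `T = supp w + supp w`), then `(Σ_a |w(a)|²)² ≤ #T · M²`, i.e. the archimedean mass `‖w‖₂²` of the
rank-one symmetric matrix `w wᵀ` is at most `√#T · ‖w∗w‖_∞`: one square is never wild. [folklore] -/
theorem rankOne_tame (w : G → ℂ) (M : ℝ) (T : Finset G)
    (hM : ∀ n, ‖∑ a, w a * w (n - a)‖ ≤ M)
    (hT : ∀ n, n ∉ T → ∑ a, w a * w (n - a) = 0) :
    (∑ a, ‖w a‖ ^ 2) ^ 2 ≤ T.card * M ^ 2 := by
  classical
  refine (sq_sum_normSq_le_sum_conv_normSq w).trans ?_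
  have hsplit : ∑ n, ‖∑ a, w a * w (n - a)‖ ^ 2 = ∑ n ∈ T, ‖∑ a, w a * w (n - a)‖ ^ 2 := by
    rw [← Finset.sum_subset (Finset.subset_univ T)]
    intro n _ hn
    rw [hT n hn, norm_zero]; ring
  rw [hsplit]
  calc ∑ n ∈ T, ‖∑ a, w a * w (n - a)‖ ^ 2 ≤ ∑ n ∈ T, M ^ 2 :=
        Finset.sum_le_sum fun n _ => pow_le_pow_left₀ (norm_nonneg _) (hM n) 2
    _ = T.card * M ^ 2 := by rw [Finset.sum_const, nsmul_eq_mul]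

end RankOne

end Summit.ValiantsHypothesis.ValiantsHypothesis.Theorems.FeketeSOSHardPaleyRIP
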